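import Summits.CriticalPhenomena.Ising3D.Control2DIndexL13
import HarnessLib

/-!
# The Λ = 15 index list of the 2D γ-certificates
(cell `pub-ising3x`, seat controls-1 gen 17; KERNEL PATH for the 2D γ-certificates, Λ = 15 — CONTROL-ONLY scaffolding)

HONEST FRAMING: lottery ticket; floor = tightest certified 3D Ising CFT bounds; no exact-solution
claim without a proof. Nothing about any CFT is asserted here.

Every Λ = 15 derivative functional of the cell (RB-3/RB-4 certificates `j117772`, `j127795`, `j127796`, `j129649`, the
RB-1 Λ = 15 gap certificates; format `deriv-functional-2d/1,2`) is a table on the same 36 pairs `(m, n)` with `m > n`,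
`m + n` odd `≤ 15` (the certificates' `index_set`, in their order): `slL13` followed by the eight pairs with
`m + n = 15`. Shared by all Λ = 15 table / cells / assembly files (successor work: the kernel replays need the
`k ≤ 15` literal library, HOME/pub-ising3x-controls-1/KP4/README §6).
-/

namespace Summit.CriticalPhenomena.Ising3D.Control2D

/-- The Λ = 15 index list: the 36 pairs `(m, n)`, `m > n`, `m + n` odd `≤ 15`. [folklore] -/
def slL15 : List (ℕ × ℕ) := [(1, 0), (3, 0), (2, 1), (5, 0), (4, 1), (3, 2), (7, 0), (6, 1), (5, 2), (4, 3),
  (9, 0), (8, 1), (7, 2), (6, 3), (5, 4), (11, 0), (10, 1), (9, 2), (8, 3), (7, 4), (6, 5),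
  (13, 0), (12, 1), (11, 2), (10, 3), (9, 4), (8, 5), (7, 6),
  (15, 0), (14, 1), (13, 2), (12, 3), (11, 4), (10, 5), (9, 6), (8, 7)]

/-- [folklore] -/
theorem slL15_nodup : slL15.Nodup := by decide

/-- [folklore] -/
theorem slL15_deg : ∀ p ∈ slL15, p.1 + p.2 ≤ 15 := by decide

/-- `slL15` extends `slL13`. [folklore] -/
theorem slL15_eq_append :
    slL15 = slL13 ++ [(15, 0), (14, 1), (13, 2), (12, 3), (11, 4), (10, 5), (9, 6), (8, 7)] := rfl

end Summit.CriticalPhenomena.Ising3D.Control2D
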